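import Mathlib

/-!
# Crux `PbContinuation` (stmt-HubbardSuperconductivity-0907; = `LevyLogBootstrap.Continuation`,
# `AnisotropyChord.Continuation`, `PolyaSchurPairBoson.Continuation`) — the mod-4 residue at the
# uniform point is NOT bookkeeping (negative-side support, cdisprove cycle 1)

The crux's anchor speaks about the checkerboard tori with `4 ∣ L` only (two `2 × 2` plaquettes per
period), while its conclusion — the summit's matrix `HasDWavePairFieldLROAt U δ` — is a `liminf` over
ALL even sides `2k` (`TwTipContinuation.Negative.summitMatrix_iff_everyGSOrder`: an eventual every-GS
bound along `Even L`). The registered skeleton `Cruxes/PbContinuation/Lines/birth.lean` isolates this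
as `stub_evenSides`: "every-GS order of `hubbardTorus 2 L 1 U` along `L ∈ 4ℕ` ⟹ along all even `L`".
This file records, sorry-free, that NOTHING model-free supports that step: a sequence with values in
`[0,1]` can be `≥ 1` on `4ℕ` and vanish on `4ℕ + 2`, so that its `liminf` along the even sides is `0`.
Hence `stub_evenSides` needs an input comparing tori of different sides (uniqueness / side-independence
of the infinite-volume ground-state order; no such tool is in the tree) — it is a thermodynamic-limit
statement about the pure Hubbard model on the sides `L ≡ 2 (mod 4)`, on which the anchor is silent.

* `not_abstractSubsequenceShape` — `¬ ∀ a : ℕ → ℝ, (∀ L, 0 ≤ a L ∧ a L ≤ 1) → (∀ m, 1 ≤ a (4m)) →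
  0 < liminf (fun k => a (2k)) atTop`.

Elementary (the indicator of `4ℕ`); folklore.
-/

namespace Summit.HubbardSuperconductivity.PbContinuation.Negative

open Filter

/-- **The subsequence shape is FALSE**: order along the sides `4ℕ` (even with a uniform constant and
values in `[0,1]`) does not give a positive `liminf` along all even sides — witness the indicator of
`4ℕ`, which vanishes at every side `2(2n+1)`. So the mod-4 residue `stub_evenSides` of the crux
`PbContinuation` is a genuine statement about the pure torus on `L ≡ 2 (mod 4)`, not bookkeeping.
[folklore] -/
theorem not_abstractSubsequenceShape :
    ¬ (∀ a : ℕ → ℝ, (∀ L, 0 ≤ a L ∧ a L ≤ 1) → (∀ m : ℕ, 1 ≤ a (4 * m)) →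
        0 < liminf (fun k : ℕ => a (2 * k)) atTop) := by
  intro h
  set a : ℕ → ℝ := fun L => if 4 ∣ L then 1 else 0 with ha
  have hb : ∀ L, 0 ≤ a L ∧ a L ≤ 1 := by
    intro L
    by_cases h4 : 4 ∣ L <;> simp [ha, h4]
  have h4m : ∀ m : ℕ, 1 ≤ a (4 * m) := by
    intro m
    simp [ha]
  have hpos := h a hb h4m
  -- along odd `k` the subsequence `a (2k)` vanishes, so its liminf is `≤ 0`
  have hfreq : ∃ᶠ k : ℕ in atTop, (fun k : ℕ => a (2 * k)) k ≤ 0 := by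
    rw [Filter.frequently_atTop]
    intro n
    refine ⟨2 * n + 1, by omega, ?_⟩
    have : ¬ (4 ∣ 2 * (2 * n + 1)) := by omega
    simp [ha, this]
  have hbdd : Filter.IsBoundedUnder (· ≥ ·) atTop (fun k : ℕ => a (2 * k)) :=
    ⟨0, Filter.eventually_map.2 (Filter.Eventually.of_forall fun k => (hb (2 * k)).1)⟩
  have hle : liminf (fun k : ℕ => a (2 * k)) atTop ≤ 0 :=
    Filter.liminf_le_of_frequently_le hfreq hbdd
  linarith

end Summit.HubbardSuperconductivity.PbContinuation.Negative
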